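import Literature.IUT.LogVolume.Theorem110ToLegendre
import HarnessLib

/-!
# [IUTchIV] Theorem 1.10 at a point of the `λ`-line FROM THE POINT SQUEEZE: Steps (ii), (iii), (viii)–(x)
# re-run through `Thm110Numerics.theorem110` for data presented as "gap ≤ δ + ((l+5)/4)·log π"

Mochizuki, *Inter-universal Teichmüller theory IV*, RIMS manuscript (Apr. 2020; = PRIMS **57** (2021)),
Thm. 1.10, statement pp. 22–23, proof Steps (ii)–(iii) pp. 24–26, (v)–(viii) pp. 27–31; applied in the proof of
Cor. 2.2 (ii) p. 46 l. 1. TAKES NO SIDE on [IUTchIII] Cor. 3.12.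

The cell's GENUINE per-point chain (abc-iut-S2's route D3, `GenuineLogThetaPoint.lean`; summit-side
`Summit.ABC.IUTFork.PointDict.logQAvoid_le_of_cor312AtDatum_explicit`) delivers [IUTchIII] Cor. 3.12 at the
Θ-data of a point `P = (F_tpd, λ)` and a prime `l` in the SQUEEZED form

  `((l+1)/24 − 1/(2l))·log(q^{∤{2,l}}(λ)) ≤ δ + ((l+5)/4)·log π`                                    (SQ)

(`deĝ̲_lgp(P_Θ) − deĝ̲(P_q) ≤ δ + arch`, with `δ` the explicit Step (v) discrepancy of the datum), and the
campaign bounds `δ` by the K-LEVEL Step (v) display of the proof of Thm. 1.10 (p. 29, final display of Step (v),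
summed over `v_ℚ ∈ 𝕍_ℚ^dst`; the `−(1/6)·log(q_{v_ℚ})` summand being already on the left of (SQ)):

  `δ ≤ (l+1)/4·{(1 + 4/l)·log(𝔡^K) + (4/l)·log(𝔰^ℚ) + (20/3)·l*_mod·log(𝔰^≤)}`                      (V)

THIS FILE proves — with ZERO new arithmetic, by instantiating abc-iut-S3's `Thm110Numerics` /
`ProofData` (`Theorem110Data.lean`) and invoking `Thm110Numerics.theorem110` (`Theorem110.lean`) through the
junction `Cor22.display_of_proofData` (`Theorem110ToLegendre.lean`) — that (SQ) + (V) + the printed Step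
(ii)/(iii) inequalities on the K-, F- and ℚ-level numbers (`ProofData.tpd_le_F/F_le/K_le/sQ_le/sLe_le`, stated
against the point's `log(𝔡^{F_tpd}) = log-diff(λ)`, `log(𝔣^{F_tpd}) = logCondAvoid P {2,l}`, `d_mod`, `e_mod`)
give the display consumed by Cor. 2.2 (ii):

  `Cor22.Display P l η_prm : (1/6)·log(q) ≤ (1 + 20·d_mod/l)·(log(𝔡^{F_tpd}) + log(𝔣^{F_tpd})) + 20·(d*_mod·l + η_prm)`

for every prime `l ≥ 7` ("`l ≠ 5`", p. 22) and every `η_prm` as in Prop. 1.6 (`IsEtaPrm`, PROVED in the tree).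
The trick is bookkeeping only: the numerics `X` of the point are given `−|log(Θ)| := −(1/2l)·log(q)`, for which
`X.Cor312` ("`−|log(q)| ≤ −|log(Θ)|`") is an equality and `ProofData.hull_le` IS (SQ) + (V); so `theorem110`'s
Step (viii) runs verbatim. Consequently the GENUINE assembly (summit-side, abc-iut-S3 `LDHGenuineDisplay`) needs
from the log-volume side exactly (SQ) (a theorem modulo `Cor22.Cor312AtDatum`, abc-iut-S2) and (V) (abc-iut-c312-d1),
and from the number-field side the Step (ii)/(iii) fields (abc-iut-L5-t15's different/conductor tower bounds).

[cite: Mochizuki2012, IUTchIV Thm. 1.10 proof Step (v) p. 29, Step (viii) p. 30–31]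
[cite: Mochizuki2012, IUTchIV Cor. 2.2 (ii) proof p. 46] [claim: Mochizuki2012, status: disputed] for every IUT
quotation. Nothing here asserts (SQ), (V) or Cor. 3.12 for any curve: all three are hypotheses.
-/

noncomputable section

namespace Literature.IUT.LogVolume

namespace Cor22

open Literature.NumberTheory.DiophantineGeometry.GenEll
open scoped Nat.Prime

variable {P : NFPoint} {l : ℕ} {η : ℝ}

/-- The right-hand side of `Cor22.Display` is nonnegative (`log-diff ≥ 0`, `log(𝔣) ≥ 0`, `η_prm > 0`), so the
display is trivial when `log(q^{∤{2,l}}(λ)) ≤ 0` (no bad place prime to `2l`).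
[cite: Mochizuki2012, IUTchIV Thm. 1.10 p. 23] -/
theorem display_of_logQAvoid_nonpos (hη : 0 < η) (hq : logQAvoid P {2, l} ≤ 0) : Display P l η := by
  unfold Display
  have hL : 0 ≤ P.logDiff + logCondAvoid P {2, l} := add_nonneg P.logDiff_nonneg (logCondAvoid_nonneg P _)
  have hd : (0 : ℝ) ≤ dmod P := Nat.cast_nonneg _
  have hl : (0 : ℝ) ≤ l := Nat.cast_nonneg _
  have h1 : 0 ≤ (1 + 20 * (dmod P : ℝ) / l) * (P.logDiff + logCondAvoid P {2, l}) :=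
    mul_nonneg (by positivity) hL
  have h2 : 0 ≤ 20 * (2 ^ 12 * 3 ^ 3 * 5 * (dmod P : ℝ) * l + η) := by positivity
  linarith

/-- **[IUTchIV] Thm. 1.10 at the point, from the squeeze.** For a prime `l ≥ 7`, `η_prm` as in Prop. 1.6, an
integer `1 ≤ e_mod ≤ d_mod`, and real numbers `δ` (the Step (v) discrepancy), `log(𝔡^K), log(𝔣^K), log(𝔰^ℚ),
log(𝔰^≤), log(𝔡^F), log(𝔣^F) ≥ 0` satisfying the printed Step (ii) inequalities (p. 24: `tpd_le_F`, `F_le`,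
`K_le`), the Step (iii) inequality (p. 26: `sQ_le`), `log(𝔰^≤) ≤ π(e*_mod·l)` (p. 25/30: `sLe_le`), the K-level
Step (v) bound (V) (`hδ`, with `l*_mod = log(e*_mod·l)`, `e*_mod = 2^12·3^3·5·e_mod`) and the point squeeze (SQ)
(`hsq`): the display `Cor22.Display P l η_prm` holds. Proof: `Thm110Numerics.theorem110` for the numerics of the
point with `−|log(Θ)| := −(1/2l)·log(q)`. [cite: Mochizuki2012, IUTchIV Thm. 1.10 proof Steps (ii)–(viii) p. 24–31]
[claim: Mochizuki2012, status: disputed] -/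
theorem display_of_squeeze (hl : l.Prime) (h7 : 7 ≤ l) (hη : IsEtaPrm η)
    {emod : ℕ} (hemod : 1 ≤ emod) (hemod' : emod ≤ dmod P)
    {δ dK cK sQ sLe dF cF : ℝ} (hdK : 0 ≤ dK) (hcK : 0 ≤ cK) (hsQ : 0 ≤ sQ) (hsLe : 0 ≤ sLe)
    (hdF : 0 ≤ dF) (hcF : 0 ≤ cF)
    (tpd_le_F : P.logDiff + logCondAvoid P {2, l} ≤ dF + cF)
    (F_le : dF + cF ≤ P.logDiff + logCondAvoid P {2, l} + Real.log (2 ^ 11 * 3 ^ 3 * 5 ^ 2))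
    (K_le : dK + cK ≤ dF + cF + 2 * Real.log l)
    (sQ_le : sQ ≤ 2 * (dmod P : ℝ) * (P.logDiff + logCondAvoid P {2, l}) + Real.log (2 * 3 * 5 * (l : ℝ)))
    (sLe_le : sLe ≤ (π (2 ^ 12 * 3 ^ 3 * 5 * emod * l) : ℝ))
    (hδ : δ ≤ ((l : ℝ) + 1) / 4 * ((1 + 4 / (l : ℝ)) * dK + 4 / (l : ℝ) * sQ
        + 20 / 3 * Real.log (((2 ^ 12 * 3 ^ 3 * 5 * emod : ℕ) : ℝ) * l) * sLe))
    (hsq : (((l : ℝ) + 1) / 24 - 1 / (2 * l)) * logQAvoid P {2, l} ≤ δ + ((l : ℝ) + 5) / 4 * Real.log Real.pi) :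
    Display P l η := by
  rcases le_or_gt (logQAvoid P {2, l}) 0 with hq | hq
  · exact display_of_logQAvoid_nonpos hη.1 hq
  -- the numerics of the point, with `−|log(Θ)| := −(1/2l)·log(q)`
  let X : Thm110Numerics :=
    { l := l
      prime_l := hl
      five_le_l := by omega
      dmod := dmod P
      one_le_dmod := dmod_pos P
      emod := emod
      one_le_emod := hemod
      emod_le_dmod := hemod'
      etaPrm := η
      etaPrm_pos := hη.1
      logDiffTpd := P.logDiff
      logDiffTpd_nonneg := P.logDiff_nonneg
      logCondTpd := logCondAvoid P {2, l}
      logCondTpd_nonneg := logCondAvoid_nonneg P _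
      logDiffF := dF
      logDiffF_nonneg := hdF
      logCondF := cF
      logCondF_nonneg := hcF
      logq := logQAvoid P {2, l}
      logq_pos := hq
      negLogTheta := -(logQAvoid P {2, l} / (2 * (l : ℝ))) }
  have hM : Matches X P l η := ⟨rfl, rfl, rfl, rfl, rfl, rfl⟩
  have hl0 : (0 : ℝ) < l := by exact_mod_cast (show 0 < l by omega)
  -- Step (v) + the squeeze IS `hull_le` for these numerics
  have hhull : -(logQAvoid P {2, l} / (2 * (l : ℝ))) ≤
      ((l : ℝ) + 1) / 4 * ((1 + 4 / (l : ℝ)) * dK - 1 / 6 * logQAvoid P {2, l} + 4 / (l : ℝ) * sQ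
        + 20 / 3 * Real.log (((2 ^ 12 * 3 ^ 3 * 5 * emod : ℕ) : ℝ) * l) * sLe)
        + ((l : ℝ) + 5) / 4 * Real.log Real.pi := by
    have e1 : ((l : ℝ) + 1) / 4 * ((1 + 4 / (l : ℝ)) * dK - 1 / 6 * logQAvoid P {2, l} + 4 / (l : ℝ) * sQ
        + 20 / 3 * Real.log (((2 ^ 12 * 3 ^ 3 * 5 * emod : ℕ) : ℝ) * l) * sLe) =
        ((l : ℝ) + 1) / 4 * ((1 + 4 / (l : ℝ)) * dK + 4 / (l : ℝ) * sQ
        + 20 / 3 * Real.log (((2 ^ 12 * 3 ^ 3 * 5 * emod : ℕ) : ℝ) * l) * sLe)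
        - ((l : ℝ) + 1) / 24 * logQAvoid P {2, l} := by ring
    have e2 : (((l : ℝ) + 1) / 24 - 1 / (2 * l)) * logQAvoid P {2, l} =
        ((l : ℝ) + 1) / 24 * logQAvoid P {2, l} - logQAvoid P {2, l} / (2 * (l : ℝ)) := by ring
    rw [e1]; rw [e2] at hsq
    linarith
  let PD : X.ProofData :=
    { logDiffK := dK
      logDiffK_nonneg := hdK
      logCondK := cK
      logCondK_nonneg := hcK
      logsQ := sQ
      logsQ_nonneg := hsQ
      logsLe := sLe
      logsLe_nonneg := hsLe
      tpd_le_F := tpd_le_F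
      F_le := F_le
      K_le := K_le
      sQ_le := sQ_le
      sLe_le := by
        show sLe ≤ (π (X.estar * X.l) : ℝ)
        exact sLe_le
      hull_le := by
        show -(logQAvoid P {2, l} / (2 * (l : ℝ))) ≤ _
        unfold Thm110Numerics.lstar Thm110Numerics.estar
        exact hhull }
  have hcor : X.Cor312 := by
    show -(logQAvoid P {2, l} / (2 * (l : ℝ))) ≤ -(logQAvoid P {2, l} / (2 * (l : ℝ)))
    exact le_rfl
  exact display_of_proofData hM PD hη (by show l ≠ 5; omega) hcor

/-- The same with `l*_mod` written as the logarithm of a real product `log(2^12·3^3·5·e_mod·l)` (the form in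
which a K-level Step (v) bound is naturally produced). [cite: Mochizuki2012, IUTchIV Thm. 1.10 proof Step (v) p. 28–29]
[claim: Mochizuki2012, status: disputed] -/
theorem display_of_squeeze' (hl : l.Prime) (h7 : 7 ≤ l) (hη : IsEtaPrm η)
    {emod : ℕ} (hemod : 1 ≤ emod) (hemod' : emod ≤ dmod P)
    {δ dK cK sQ sLe dF cF : ℝ} (hdK : 0 ≤ dK) (hcK : 0 ≤ cK) (hsQ : 0 ≤ sQ) (hsLe : 0 ≤ sLe)
    (hdF : 0 ≤ dF) (hcF : 0 ≤ cF)
    (tpd_le_F : P.logDiff + logCondAvoid P {2, l} ≤ dF + cF)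
    (F_le : dF + cF ≤ P.logDiff + logCondAvoid P {2, l} + Real.log (2 ^ 11 * 3 ^ 3 * 5 ^ 2))
    (K_le : dK + cK ≤ dF + cF + 2 * Real.log l)
    (sQ_le : sQ ≤ 2 * (dmod P : ℝ) * (P.logDiff + logCondAvoid P {2, l}) + Real.log (2 * 3 * 5 * (l : ℝ)))
    (sLe_le : sLe ≤ (π (2 ^ 12 * 3 ^ 3 * 5 * emod * l) : ℝ))
    (hδ : δ ≤ ((l : ℝ) + 1) / 4 * ((1 + 4 / (l : ℝ)) * dK + 4 / (l : ℝ) * sQ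
        + 20 / 3 * Real.log ((2 : ℝ) ^ 12 * 3 ^ 3 * 5 * emod * l) * sLe))
    (hsq : (((l : ℝ) + 1) / 24 - 1 / (2 * l)) * logQAvoid P {2, l} ≤ δ + ((l : ℝ) + 5) / 4 * Real.log Real.pi) :
    Display P l η := by
  have e : ((2 : ℝ) ^ 12 * 3 ^ 3 * 5 * emod * l) = (((2 ^ 12 * 3 ^ 3 * 5 * emod : ℕ) : ℝ) * l) := by
    push_cast; ring
  rw [e] at hδ
  exact display_of_squeeze hl h7 hη hemod hemod' hdK hcK hsQ hsLe hdF hcF tpd_le_F F_le K_le sQ_le sLe_le hδ hsq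

/-- **The minimal form: only the numbers that the log-volume side pins are constrained.** Of the Step (ii)
fields of `ProofData` only `log(𝔡^K)` is used by the hull bound (V); `log(𝔣^K)`, `log(𝔡^F)`, `log(𝔣^F)` enter
Thm. 1.10 only through the CHAIN `tpd ≤ F ≤ tpd + log(2^11·3^3·5^2)`, `K ≤ F + 2·log l` (p. 24), whose sole
consequence for the display is the COMBINED Step (ii) bound

  `log(𝔡^K) ≤ log(𝔡^{F_tpd}) + log(𝔣^{F_tpd}) + log(2^11·3^3·5^2) + 2·log(l)`                      (ii-K)

(instantiate `log(𝔣^K) := 0`, `log(𝔡^F) := log(𝔡^{F_tpd}) + log(2^11·3^3·5^2)`, `log(𝔣^F) := log(𝔣^{F_tpd})`).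
So: for a prime `l ≥ 7`, `η_prm` as in Prop. 1.6, `1 ≤ e_mod ≤ d_mod`, nonnegative reals `log(𝔡^K)`,
`log(𝔰^ℚ)`, `log(𝔰^≤)` with (ii-K), the Step (iii) bound `log(𝔰^ℚ) ≤ 2·d_mod·(log(𝔡^{F_tpd}) + log(𝔣^{F_tpd})) +
log(2·3·5·l)` (p. 26), `log(𝔰^≤) ≤ π(e*_mod·l)`, the K-level Step (v) bound (V) on `δ` and the point squeeze
(SQ): `Cor22.Display P l η_prm`. This is the exact list of per-point inputs the genuine assembly has to supply.
[cite: Mochizuki2012, IUTchIV Thm. 1.10 proof Step (ii) p. 24, Step (iii) p. 26, Step (v) p. 29, Step (viii) p. 30–31]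
[claim: Mochizuki2012, status: disputed] -/
theorem display_of_squeeze_min (hl : l.Prime) (h7 : 7 ≤ l) (hη : IsEtaPrm η)
    {emod : ℕ} (hemod : 1 ≤ emod) (hemod' : emod ≤ dmod P)
    {δ dK sQ sLe : ℝ} (hdK : 0 ≤ dK) (hsQ : 0 ≤ sQ) (hsLe : 0 ≤ sLe)
    (hK : dK ≤ P.logDiff + logCondAvoid P {2, l} + Real.log (2 ^ 11 * 3 ^ 3 * 5 ^ 2) + 2 * Real.log l)
    (hsQle : sQ ≤ 2 * (dmod P : ℝ) * (P.logDiff + logCondAvoid P {2, l}) + Real.log (2 * 3 * 5 * (l : ℝ)))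
    (hsLele : sLe ≤ (π (2 ^ 12 * 3 ^ 3 * 5 * emod * l) : ℝ))
    (hδ : δ ≤ ((l : ℝ) + 1) / 4 * ((1 + 4 / (l : ℝ)) * dK + 4 / (l : ℝ) * sQ
        + 20 / 3 * Real.log ((2 : ℝ) ^ 12 * 3 ^ 3 * 5 * emod * l) * sLe))
    (hsq : (((l : ℝ) + 1) / 24 - 1 / (2 * l)) * logQAvoid P {2, l} ≤ δ + ((l : ℝ) + 5) / 4 * Real.log Real.pi) :
    Display P l η := by
  have hL : 0 ≤ Real.log (2 ^ 11 * 3 ^ 3 * 5 ^ 2 : ℝ) := Real.log_nonneg (by norm_num)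
  have hd : 0 ≤ P.logDiff := P.logDiff_nonneg
  have hc : 0 ≤ logCondAvoid P {2, l} := logCondAvoid_nonneg P _
  exact display_of_squeeze' (cK := 0) (dF := P.logDiff + Real.log (2 ^ 11 * 3 ^ 3 * 5 ^ 2))
    (cF := logCondAvoid P {2, l}) hl h7 hη hemod hemod' hdK le_rfl hsQ hsLe (add_nonneg hd hL) hc
    (by linarith) (by linarith) (by linarith) hsQle hsLele hδ hsq

end Cor22

end Literature.IUT.LogVolume

end
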